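import Mathlib
import HarnessLib
import Summits.QuantumFields.YangMills.Theses.GronwallGap
import Summits.QuantumFields.YangMills.Theorems.GronwallGapPathGapModulusNearHaarFloor
import Literature.MathematicalPhysics.QuantumFieldTheory.PlaquetteWeightTorusDobrushin

/-!
# `PathGapModulus` (stmt-QuantumFields-13946) — the Dobrushin region (verified strong coupling at realistic size)

Helper for the crux `Summit.QuantumFields.YangMills.Theses.GronwallGap.PathGapModulus` (route
`GronwallGap`, line `registered`, stubs S1 `stub_clusteringOpen` / S2loc `stub_localRateFloor` /
S3b `stub_uniformConstantsAtCommonRate`). The stubs are open-problem-sized off strong coupling; the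
crux is VERIFIED on the set of admissible paths whose weights stay Haar-perturbative. Until now that
set was the Kotecký–Preiss polydisc `sup |log w s| ≤ betaR 1 (3⁴·4²)/4 ≈ 10^(−672.8)`
(`pathGapModulus_of_nearHaar`, from the Osterwalder–Seiler cluster expansion). This file replaces it
by **Dobrushin's uniqueness region in the total-variation form**
(`Literature.MathematicalPhysics.QuantumFieldTheory.plaquetteWeight_torusClustering_dobrushin`):
`(3/2)(e^{12·osc(log w s)} − 1) < 1`, i.e. `osc (log w s) < log(5/3)/12 ≈ 4.26·10⁻²` — 671 orders of
magnitude wider, the same qualitative (Haar-perturbative) status: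

* `plaquetteWeight_dobrushin_uniformClustering` — in the crux's verbatim predicate `UCw`: for every
  compact simple `G` and every `δ` with `(3/2)(e^{12δ} − 1) < 1` there is `m > 0` with
  `UCw (fun _ => v) 0 m` for every continuous `v > 0` with `osc (log v) ≤ δ`;
* `pathGap_localFloor_dobrushin` — the conclusion of `stub_localRateFloor`/`stub_clusteringOpen`
  around every parameter `s₀` of an admissible path with `osc (log w s₀) ≤ δ` (openness of the
  strict Dobrushin condition + the log-Lipschitz constant of `Adm`);
* `pathGapModulus_of_dobrushinRegion` — the crux's conclusion (`K := 0`, `M := m`) for every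
  admissible path staying in the region. The certificate `AnP` is not used.
-/

namespace Summit.QuantumFields.YangMills.Theorems

open MeasureTheory Filter Topology
open Literature.MathematicalPhysics.QuantumFieldTheory
open Literature.MathematicalPhysics.QuantumLattice (configShift toTorusObservable torusLift)

/-- A compact group with a faithful continuous finite-dimensional representation is Hausdorff
(it embeds into a matrix space). [folklore] -/
theorem t2Space_of_latticeRep {G : Type} [Group G] [TopologicalSpace G] [CompactSpace G]
    (r : LatticeRep G) : T2Space G :=
  ((r.continuous.isClosedEmbedding r.injective).isEmbedding).t2Space

/-- **General-weight Dobrushin region in the crux's clustering shape** (`d = 4`): for every compact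
simple Lie group `G` and every `δ` with `(3/2)(e^{12δ} − 1) < 1` there is `m > 0` (depending on `δ`
only) such that for every continuous `v : G → ℝ`, `v > 0`, with `osc (log v) ≤ δ`, the
plaquette-weight torus theories of `v` cluster volume-uniformly at rate `m` (`UCw (fun _ => v) 0 m`,
the crux's verbatim predicate) — Dobrushin's uniqueness technique in the total-variation form.
[cite: Follmer1988, Ch. I Theorem (2.13)] -/
theorem plaquetteWeight_dobrushin_uniformClustering :
    ∀ (G : Type) [Group G] [TopologicalSpace G] [IsTopologicalGroup G] [CompactSpace G],
      Literature.MathematicalPhysics.QuantumFieldTheory.IsCompactSimpleLieGroup G →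
      letI : MeasurableSpace G := borel G; haveI : BorelSpace G := ⟨rfl⟩;
      let UCw : (ℝ → G → ℝ) → ℝ → ℝ → Prop := fun w s m => ∀ A B : Literature.MathematicalPhysics.QuantumFieldTheory.YMSpecies G, ∃ C : ℝ, ∃ S₀ : ℕ, ∀ S : ℕ, S₀ ≤ S → ∀ n : ℕ, n ≤ S → |(∫ U, A.F (Literature.MathematicalPhysics.QuantumLattice.torusLift (2 * S + 1) U) * B.F (Literature.MathematicalPhysics.QuantumLattice.configShift (-Pi.single 0 (n : ℤ)) (Literature.MathematicalPhysics.QuantumLattice.torusLift (2 * S + 1) U)) ∂(Literature.MathematicalPhysics.QuantumLattice.groupHeatKernelMeasure (d := 4) (L := 2 * S + 1) w s)) - (∫ U, A.F (Literature.MathematicalPhysics.QuantumLattice.torusLift (2 * S + 1) U) ∂(Literature.MathematicalPhysics.QuantumLattice.groupHeatKernelMeasure (d := 4) (L := 2 * S + 1) w s)) * (∫ U, B.F (Literature.MathematicalPhysics.QuantumLattice.torusLift (2 * S + 1) U) ∂(Literature.MathematicalPhysics.QuantumLattice.groupHeatKernelMeasure (d := 4) (L := 2 * S + 1) w s))| ≤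 C * Real.exp (-(m * n));
      ∀ δ : ℝ, 3 / 2 * (Real.exp (12 * δ) - 1) < 1 →
      ∃ m : ℝ, 0 < m ∧ ∀ v : G → ℝ, Continuous v → (∀ g, 0 < v g) →
        (∀ a b : G, |Real.log (v a) - Real.log (v b)| ≤ δ) → UCw (fun _ => v) 0 m := by
  intro G _ _ _ _ hG
  letI : MeasurableSpace G := borel G
  haveI : BorelSpace G := ⟨rfl⟩
  intro UCw δ hδ
  obtain ⟨-, ⟨r⟩⟩ := hG
  haveI : SecondCountableTopology G := secondCountable_of_latticeRep r
  haveI : T2Space G := t2Space_of_latticeRep r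
  have hδ' : 3 / 2 * (Real.exp (4 * ((4 - 1 : ℕ) : ℝ) * δ) - 1) < 1 := by norm_num; exact hδ
  obtain ⟨m, hm, h⟩ :=
    plaquetteWeight_torusClustering_dobrushin (d := 4) (G := G) (by norm_num) hδ'
  refine ⟨m, hm, fun v hv hv0 hvδ A B => ?_⟩
  obtain ⟨C, hC⟩ := h v hv hv0 hvδ (fun _ => v) (fun _ => rfl) A.F B.F ⟨A.supp, A.isCylinder⟩
    ⟨B.supp, B.isCylinder⟩ A.measurable B.measurable A.bounded B.bounded
  refine ⟨C, 0, fun S _ n hn => ?_⟩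
  set x : Literature.Probability.LatticeModels.Site 4 := -Pi.single 0 (n : ℤ) with hx
  have hxn : ‖x‖ = n := by
    rw [hx, norm_neg, Pi.norm_single, Int.norm_natCast]
  have hlt : 2 * ‖x‖ < ((2 * S : ℕ) : ℝ) + 1 := by
    rw [hxn]; push_cast
    have : (n : ℝ) ≤ S := by exact_mod_cast hn
    linarith
  have key := hC (2 * S) x hlt
  -- translation invariance for `⟨B⟩`
  have e2 : ∫ V, toTorusObservable (2 * S + 1) (B.F ∘ configShift x) V
        ∂(Literature.MathematicalPhysics.QuantumLattice.groupHeatKernelMeasure (d := 4)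
          (L := 2 * S + 1) (fun _ => v) 0) =
      ∫ V, toTorusObservable (2 * S + 1) B.F V
        ∂(Literature.MathematicalPhysics.QuantumLattice.groupHeatKernelMeasure (d := 4)
          (L := 2 * S + 1) (fun _ => v) 0) := by
    rw [toTorusObservable_comp_configShift]
    exact integral_groupHeatKernelMeasure_comp_torusConfigShift _ _ _ _
  rw [e2, hxn] at key
  have e3 : -m * (n : ℝ) = -(m * n) := by ring
  rw [e3] at key
  exact key

/-- The strict Dobrushin condition is an open condition: room `η > 0` above `δ`. [folklore] -/
theorem exists_dobrushin_room {δ : ℝ} (hδ : 3 / 2 * (Real.exp (12 * δ) - 1) < 1) :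
    ∃ η : ℝ, 0 < η ∧ 3 / 2 * (Real.exp (12 * (δ + η)) - 1) < 1 := by
  have hcont : Continuous fun t : ℝ => 3 / 2 * (Real.exp (12 * t) - 1) := by fun_prop
  have hopen : IsOpen {t : ℝ | 3 / 2 * (Real.exp (12 * t) - 1) < 1} :=
    isOpen_lt hcont continuous_const
  obtain ⟨η, hη0, hball⟩ := Metric.isOpen_iff.1 hopen δ hδ
  refine ⟨η / 2, by positivity, hball ?_⟩
  rw [Metric.mem_ball, Real.dist_eq]
  rw [show δ + η / 2 - δ = η / 2 by ring, abs_of_pos (by positivity)]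
  linarith

/-- **Dobrushin local floor (the realistic constant-reference case of `stub_localRateFloor` and
`stub_clusteringOpen`).** Along an admissible weight path (crux predicates `UCw`, `Adm` verbatim; only
continuity, positivity and the log-Lipschitz constant `Λ` of `Adm` are used), every parameter `s₀`
whose weight satisfies Dobrushin's condition with room, `osc (log w s₀) ≤ δ`, `(3/2)(e^{12δ}−1) < 1`,
has a neighbourhood in `[0,1]` on which all the theories cluster volume-uniformly at ONE rate `μ > 0`.
[folklore] -/
theorem pathGap_localFloor_dobrushin :
    ∀ (G : Type) [Group G] [TopologicalSpace G] [IsTopologicalGroup G] [CompactSpace G],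
      Literature.MathematicalPhysics.QuantumFieldTheory.IsCompactSimpleLieGroup G →
      letI : MeasurableSpace G := borel G; haveI : BorelSpace G := ⟨rfl⟩;
      let UCw : (ℝ → G → ℝ) → ℝ → ℝ → Prop := fun w s m => ∀ A B : Literature.MathematicalPhysics.QuantumFieldTheory.YMSpecies G, ∃ C : ℝ, ∃ S₀ : ℕ, ∀ S : ℕ, S₀ ≤ S → ∀ n : ℕ, n ≤ S → |(∫ U, A.F (Literature.MathematicalPhysics.QuantumLattice.torusLift (2 * S + 1) U) * B.F (Literature.MathematicalPhysics.QuantumLattice.configShift (-Pi.single 0 (n : ℤ)) (Literature.MathematicalPhysics.QuantumLattice.torusLift (2 * S + 1) U)) ∂(Literature.MathematicalPhysics.QuantumLattice.groupHeatKernelMeasure (d := 4) (L := 2 * S + 1) w s)) - (∫ U, A.F (Literature.MathematicalPhysics.QuantumLattice.torusLift (2 * S + 1) U) ∂(Literature.MathematicalPhysics.QuantumLattice.groupHeatKernelMeasure (d := 4) (L := 2 * S + 1) w s)) * (∫ U, B.F (Literature.MathematicalPhysics.QuantumLattice.torusLift (2 * S + 1) U) ∂(Literature.MathematicalPhysics.QuantumLattice.groupHeatKernelMeasure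 (d := 4) (L := 2 * S + 1) w s))| ≤ C * Real.exp (-(m * n));
      let Adm : (ℝ → G → ℝ) → Prop := fun w => (∀ s ∈ Set.Icc (0 : ℝ) 1, Continuous (w s) ∧ (∀ g : G, 0 < w s g) ∧ (∀ g h : G, w s (h * g * h⁻¹) = w s g) ∧ (∀ g : G, w s g⁻¹ = w s g) ∧ (∀ (n : ℕ) (x : Fin n → G) (c : Fin n → ℂ), 0 ≤ (∑ i, ∑ j, (starRingEnd ℂ) (c i) * c j * ((w s ((x i)⁻¹ * x j) : ℝ) : ℂ)).re)) ∧ ∃ Λ : ℝ, ∀ s ∈ Set.Icc (0 : ℝ) 1, ∀ s' ∈ Set.Icc (0 : ℝ) 1, ∀ g : G, |Real.log (w s g) - Real.log (w s' g)| ≤ Λ * |s - s'|;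
      ∀ w : ℝ → G → ℝ, Adm w → ∀ s₀ ∈ Set.Icc (0 : ℝ) 1, ∀ δ : ℝ, 3 / 2 * (Real.exp (12 * δ) - 1) < 1 →
        (∀ a b : G, |Real.log (w s₀ a) - Real.log (w s₀ b)| ≤ δ) →
        ∃ ε μ : ℝ, 0 < ε ∧ 0 < μ ∧ ∀ s ∈ Set.Icc (0 : ℝ) 1, |s - s₀| < ε → UCw w s μ := by
  intro G _ _ _ _ hG
  letI : MeasurableSpace G := borel G
  haveI : BorelSpace G := ⟨rfl⟩
  intro UCw Adm w hAdm s₀ hs₀ δ hδ hosc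
  obtain ⟨η, hη0, hδη⟩ := exists_dobrushin_room hδ
  obtain ⟨m, hm, hUC⟩ := plaquetteWeight_dobrushin_uniformClustering G hG (δ + η) hδη
  obtain ⟨hreg, Λ, hΛ⟩ := hAdm
  have hΛ1 : 0 < 2 * (|Λ| + 1) := by positivity
  set ε : ℝ := η / (2 * (|Λ| + 1)) with hε
  have hε0 : 0 < ε := by positivity
  have hεη : 2 * (|Λ| + 1) * ε = η := by
    rw [hε]; field_simp
  refine ⟨ε, m, hε0, hm, fun s hs hdist => ?_⟩
  obtain ⟨hcont, hpos, -, -, -⟩ := hreg s hs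
  have hstep : ∀ g : G, |Real.log (w s g) - Real.log (w s₀ g)| ≤ (|Λ| + 1) * ε := fun g =>
    calc |Real.log (w s g) - Real.log (w s₀ g)| ≤ Λ * |s - s₀| := hΛ s hs s₀ hs₀ g
      _ ≤ |Λ| * |s - s₀| := mul_le_mul_of_nonneg_right (le_abs_self Λ) (abs_nonneg _)
      _ ≤ |Λ| * ε := mul_le_mul_of_nonneg_left hdist.le (abs_nonneg _)
      _ ≤ (|Λ| + 1) * ε := mul_le_mul_of_nonneg_right (by linarith [abs_nonneg Λ]) hε0.le
  have hosc' : ∀ a b : G, |Real.log (w s a) - Real.log (w s b)| ≤ δ + η := fun a b => by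
    have ha := hstep a
    have hb := hstep b
    have hab := hosc a b
    calc |Real.log (w s a) - Real.log (w s b)|
        = |(Real.log (w s a) - Real.log (w s₀ a)) + (Real.log (w s₀ a) - Real.log (w s₀ b)) -
            (Real.log (w s b) - Real.log (w s₀ b))| := by ring_nf
      _ ≤ |(Real.log (w s a) - Real.log (w s₀ a)) + (Real.log (w s₀ a) - Real.log (w s₀ b))| +
            |Real.log (w s b) - Real.log (w s₀ b)| := abs_sub _ _
      _ ≤ |Real.log (w s a) - Real.log (w s₀ a)| + |Real.log (w s₀ a) - Real.log (w s₀ b)| +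
            |Real.log (w s b) - Real.log (w s₀ b)| := by
          gcongr
          exact abs_add_le _ _
      _ ≤ (|Λ| + 1) * ε + δ + (|Λ| + 1) * ε := by linarith
      _ = δ + η := by linarith
  exact hUC (w s) hcont hpos hosc'

/-- **`PathGapModulus` on the Dobrushin region.** For every compact simple `G` and every admissible
weight path `w` all of whose weights satisfy Dobrushin's total-variation condition,
`osc (log w s) ≤ δ` with `(3/2)(e^{12δ} − 1) < 1` (e.g. `sup_s sup_g |log w s g| ≤ 2.1·10⁻²`), the
conclusion of the crux holds — with `K := 0` and cap `M := m`, the Dobrushin rate of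
`plaquetteWeight_dobrushin_uniformClustering`: every parameter's theory clusters at rate `m`, and the
clustering bound is antitone in the rate (`pathGap_clusterBound_antitone`). The analytic-pressure
certificate is not needed on this region; it supersedes `pathGapModulus_of_nearHaar` (polydisc radius
`≈ 10^(−672.8)`) as the verified region of the crux. [folklore] -/
theorem pathGapModulus_of_dobrushinRegion :
    ∀ (G : Type) [Group G] [TopologicalSpace G] [IsTopologicalGroup G] [CompactSpace G],
      Literature.MathematicalPhysics.QuantumFieldTheory.IsCompactSimpleLieGroup G →
      letI : MeasurableSpace G := borel G; haveI : BorelSpace G := ⟨rfl⟩;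
      let UCw : (ℝ → G → ℝ) → ℝ → ℝ → Prop := fun w s m => ∀ A B : Literature.MathematicalPhysics.QuantumFieldTheory.YMSpecies G, ∃ C : ℝ, ∃ S₀ : ℕ, ∀ S : ℕ, S₀ ≤ S → ∀ n : ℕ, n ≤ S → |(∫ U, A.F (Literature.MathematicalPhysics.QuantumLattice.torusLift (2 * S + 1) U) * B.F (Literature.MathematicalPhysics.QuantumLattice.configShift (-Pi.single 0 (n : ℤ)) (Literature.MathematicalPhysics.QuantumLattice.torusLift (2 * S + 1) U)) ∂(Literature.MathematicalPhysics.QuantumLattice.groupHeatKernelMeasure (d := 4) (L := 2 * S + 1) w s)) - (∫ U, A.F (Literature.MathematicalPhysics.QuantumLattice.torusLift (2 * S + 1) U) ∂(Literature.MathematicalPhysics.QuantumLattice.groupHeatKernelMeasure (d := 4) (L := 2 * S + 1) w s)) * (∫ U, B.F (Literature.MathematicalPhysics.QuantumLattice.torusLift (2 * S + 1) U) ∂(Literature.MathematicalPhysics.QuantumLattice.groupHeatKernelMeasure (d := 4) (L := 2 * S + 1) w s))| ≤ C * Real.exp (-(m * n));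
      let Adm : (ℝ → G → ℝ) → Prop := fun w => (∀ s ∈ Set.Icc (0 : ℝ) 1, Continuous (w s) ∧ (∀ g : G, 0 < w s g) ∧ (∀ g h : G, w s (h * g * h⁻¹) = w s g) ∧ (∀ g : G, w s g⁻¹ = w s g) ∧ (∀ (n : ℕ) (x : Fin n → G) (c : Fin n → ℂ), 0 ≤ (∑ i, ∑ j, (starRingEnd ℂ) (c i) * c j * ((w s ((x i)⁻¹ * x j) : ℝ) : ℂ)).re)) ∧ ∃ Λ : ℝ, ∀ s ∈ Set.Icc (0 : ℝ) 1, ∀ s' ∈ Set.Icc (0 : ℝ) 1, ∀ g : G, |Real.log (w s g) - Real.log (w s' g)| ≤ Λ * |s - s'|;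
      ∀ w : ℝ → G → ℝ, Adm w → ∀ δ : ℝ, 3 / 2 * (Real.exp (12 * δ) - 1) < 1 →
        (∀ s ∈ Set.Icc (0 : ℝ) 1, ∀ a b : G, |Real.log (w s a) - Real.log (w s b)| ≤ δ) →
        ∃ K M : ℝ, 0 < M ∧ ∀ s ∈ Set.Icc (0 : ℝ) 1, ∀ s' ∈ Set.Icc (0 : ℝ) 1, ∀ m : ℝ, 0 < m → UCw w s m →
          ∀ m' : ℝ, 0 < m' → m' < min m M * Real.exp (-(K * |s' - s|)) → UCw w s' m' := by
  intro G _ _ _ _ hG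
  letI : MeasurableSpace G := borel G
  haveI : BorelSpace G := ⟨rfl⟩
  intro UCw Adm w hAdm δ hδ hosc
  obtain ⟨m, hm, hUC⟩ := plaquetteWeight_dobrushin_uniformClustering G hG δ hδ
  refine ⟨0, m, hm, ?_⟩
  intro s hs s' hs' m₀ hm₀ _ m' hm' hlt
  obtain ⟨hcont, hpos, -⟩ := hAdm.1 s' hs'
  have hU : UCw w s' m := hUC (w s') hcont hpos (hosc s' hs')
  have hle : m' ≤ m := by
    have h1 : min m₀ m * Real.exp (-(0 * |s' - s|)) = min m₀ m := by simp
    rw [h1] at hlt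
    exact hlt.le.trans (min_le_right _ _)
  exact fun A B => pathGap_clusterBound_antitone hle (hU A B)

end Summit.QuantumFields.YangMills.Theorems
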